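import Summits.AtomisticToContinuum.Crystallization.Theorems.FrustratedLawDichotomyStrainedPatchHomLeafTableSound

/-!
# v2 leaf checker — the fcc COROLLARY: far labels from `‖G − 1‖ ≤ 1/4` (critic row 806 (2)(C))

decomp-a2c hand-1 g20 (crux `AperiodicFrustratedLawGap`, stmt-AtomisticToContinuum-27623).  For the fcc frame `fccVec` (Gram `1` on the diagonal, `1/2` off
it): `‖Σ bᵢ fccVec i‖² = n_b := Σbᵢ² + Σ_{i<j} bᵢbⱼ`, hence `‖G − 1‖ ≤ 1/4` makes every label with `n_b ≥ 36` far (`‖latPt G fccVec b‖ ≥ ¾·6 = 9/2`).  With the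
label list COVERING all labels of norm `≤ 35` up to sign and SORTED by `n`, and the stop norm `≥ 36`, the two far-hypotheses of `leafCheck_sound` are
discharged: ★ `leafCheck_sound_fcc`.  0 sorry; standard axioms.  `--supports stmt-AtomisticToContinuum-27623`.
-/

noncomputable section

namespace Summit.AtomisticToContinuum.Crystallization.Theorems.FrustratedLawDichotomyStrainedPatchHomLeafTableCheck

open scoped BigOperators RealInnerProductSpace
open Set
open Literature.Analysis.ValidatedNumerics.Numerics
open Summit.AtomisticToContinuum.Crystallization.Theorems.ChargedEnergyGapNegative (E3)
open Summit.AtomisticToContinuum.Crystallization.Theorems.FrustratedLawDichotomySchurCut (effPot w₄₅ ω₄)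
open Summit.AtomisticToContinuum.Crystallization.Theorems.FrustratedLawDichotomyStrainedPatchHomSplit (latPt)
open Summit.AtomisticToContinuum.Crystallization.Theorems.FrustratedLawDichotomyStrainedPatchHomGram (norm_sq_map_sum_smul)
open Summit.AtomisticToContinuum.Crystallization.Theorems.FrustratedLawDichotomyStrainedPatchHomPolar (norm_apply_ge_of_norm_sub_one_le)
open Literature.Barriers.AtomisticToContinuum.FlatleyTheil2015 (fccVec)

/-! ## §1. The fcc Gram form -/

/-- Gram matrix of the fcc frame: `⟪fᵢ, fⱼ⟫ = 1` if `i = j`, `1/2` otherwise (the computation of Literature `FlatleyTheil2015FccLatticeLayers`,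
where it is private). [cite: FlatleyTheil2015, §1 (arXiv p. 3)] -/
theorem inner_fccVec_eq (i j : Fin 3) : ⟪fccVec i, fccVec j⟫ = if i = j then (1 : ℝ) else 1 / 2 := by
  have hs : (Real.sqrt 2)⁻¹ * (Real.sqrt 2)⁻¹ = 2⁻¹ := by
    rw [← mul_inv, Real.mul_self_sqrt (by norm_num)]
  fin_cases i <;> fin_cases j <;>
    simp only [PiLp.inner_apply, RCLike.inner_apply, conj_trivial, Fin.sum_univ_three] <;>
    simp [fccVec] <;> linarith [hs]

/-- The integer fcc norm of a label. -/
def nbZ (b : Fin 3 → ℤ) : ℤ := b 0 * b 0 + b 1 * b 1 + b 2 * b 2 + b 0 * b 1 + b 0 * b 2 + b 1 * b 2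

/-- `‖Σ bᵢ fccVec i‖² = n_b`. [folklore] -/
theorem norm_sq_fccComb (b : Fin 3 → ℤ) : ‖∑ i : Fin 3, ((b i : ℤ) : ℝ) • fccVec i‖ ^ 2 = ((nbZ b : ℤ) : ℝ) := by
  have h := norm_sq_map_sum_smul (1 : E3 →L[ℝ] E3) fccVec (fun i => ((b i : ℤ) : ℝ))
  simp only [one_apply_eq_self] at h
  rw [h]
  simp only [Fin.sum_univ_three, inner_fccVec_eq, nbZ]
  simp only [Fin.isValue, ↓reduceIte, Fin.zero_eq_one_iff, Fin.one_eq_zero_iff, OfNat.ofNat_ne_one, Fin.reduceEq]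
  push_cast
  ring

/-- FAR BY NORM: `‖G − 1‖ ≤ 1/4` and `36 ≤ n_b` give `9/2 ≤ ‖latPt G fccVec b‖`. [folklore] -/
theorem far_of_nb {G : E3 →L[ℝ] E3} (hG : ‖G - 1‖ ≤ 1 / 4) {b : Fin 3 → ℤ} (hb : 36 ≤ nbZ b) : 9 / 2 ≤ ‖latPt G fccVec b‖ := by
  unfold latPt
  have h1 := norm_apply_ge_of_norm_sub_one_le hG (∑ i : Fin 3, ((b i : ℤ) : ℝ) • fccVec i)
  have hsq := norm_sq_fccComb b
  have h36 : (36 : ℝ) ≤ ‖∑ i : Fin 3, ((b i : ℤ) : ℝ) • fccVec i‖ ^ 2 := by rw [hsq]; exact_mod_cast hb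
  have h6 : (6 : ℝ) ≤ ‖∑ i : Fin 3, ((b i : ℤ) : ℝ) • fccVec i‖ := by nlinarith [norm_nonneg (∑ i : Fin 3, ((b i : ℤ) : ℝ) • fccVec i)]
  linarith

/-- A record's `n` is the fcc norm of its label. [formal bookkeeping] -/
theorem NL.n_eq {l : NL} (hl : l.ok = true) : (l.n : ℤ) = nbZ l.toLab := by
  obtain ⟨hn, -⟩ := (NL.ok_iff l).1 hl
  rw [hn]
  simp [nbZ, NL.toLab]

/-- `nbZ (−b) = nbZ b`. [formal bookkeeping] -/
theorem nbZ_neg (b : Fin 3 → ℤ) : nbZ (-b) = nbZ b := by simp [nbZ]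

/-! ## §2. The corollary -/

/-- ★ **SOUNDNESS OF THE v2 LEAF CHECK, fcc frame, far labels from `‖G − 1‖ ≤ 1/4`.**  Besides the certified table and the list invariants of
`leafCheck_sound`, the list must COVER every box label of fcc norm `≤ 35` up to sign and be SORTED by `n`, and the stop norm must be `≥ 36`.
Then a passing `leafCheck` bounds the fcc box sum of every `G` with `‖G − 1‖ ≤ 1/4` whose frame Gram data lie in the box. [folklore] -/
theorem leafCheck_sound_fcc {tab : QT} {labs : List NL} {E A0 A1 A2 A3 A4 A5 nstop : ℕ} {g : GB} {sμ : Bool} {aμ : ℕ}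
    (htab : tab.allOK E = true) (hok : ∀ l ∈ labs, l.ok = true)
    (hbox7 : ∀ l ∈ labs, l.toLab ∈ (Fintype.piFinset fun _ : Fin 3 => Finset.Icc (-7 : ℤ) 7).filter (fun b => b ≠ 0))
    (hcanon : ∀ l ∈ labs, ∀ l' ∈ labs, l.toLab ≠ -l'.toLab) (hnd : (labs.map NL.toLab).Nodup)
    (hA : (labs.map NL.m00).sum ≤ A0 ∧ (labs.map NL.m11).sum ≤ A1 ∧ (labs.map NL.m22).sum ≤ A2 ∧ (labs.map NL.m01).sum ≤ A3 ∧
      (labs.map NL.m02).sum ≤ A4 ∧ (labs.map NL.m12).sum ≤ A5)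
    (hcovN : ∀ b ∈ (Fintype.piFinset fun _ : Fin 3 => Finset.Icc (-7 : ℤ) 7).filter (fun b => b ≠ 0), nbZ b ≤ 35 →
      ∃ l ∈ labs, l.toLab = b ∨ l.toLab = -b)
    (hsorted : labs.Pairwise (fun x y => x.n ≤ y.n)) (hn : 36 ≤ nstop)
    (h : leafCheck tab labs E A0 A1 A2 A3 A4 A5 nstop g sμ aμ = true) (G : E3 →L[ℝ] E3) (hG : ‖G - 1‖ ≤ 1 / 4)
    (hbox : ∀ i j : Fin 3, |⟪G (fccVec i), G (fccVec j)⟫ - ((g.cz i j : ℤ) : ℝ) / SC| ≤ ((g.wz i j : ℤ) : ℝ) / SC) :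
    ((sgnZ sμ aμ : ℤ) : ℝ) / SC ≤
      ∑ b ∈ (Fintype.piFinset fun _ : Fin 3 => Finset.Icc (-7 : ℤ) 7).filter (fun b => b ≠ 0), effPot w₄₅ ω₄ (3 / 400) ‖latPt G fccVec b‖ := by
  refine leafCheck_sound htab hok hbox7 hcanon hnd hA h fccVec G hbox (fun b hb => ?_) (fun l hl hv => ?_)
  · by_cases h35 : nbZ b ≤ 35
    · exact Or.inl (hcovN b hb h35)
    · exact Or.inr (far_of_nb hG (by omega))
  · have hge := le_of_not_mem_visited nstop labs hsorted l hl hv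
    refine far_of_nb hG ?_
    rw [← NL.n_eq (hok l hl)]
    exact_mod_cast hn.trans hge

end Summit.AtomisticToContinuum.Crystallization.Theorems.FrustratedLawDichotomyStrainedPatchHomLeafTableCheck

end
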